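import Mathlib
import Summits.MatrixMultiplication.MatrixMultiplication.Theses.GLnSeparatingDesigns
import Summits.MatrixMultiplication.MatrixMultiplication.Theorems.GLnSeparatingDesignsBorderHalfDimensionDesignsStubNotCruxOfLaw
import Summits.MatrixMultiplication.MatrixMultiplication.Theorems.GLnSeparatingDesignsBorderHalfDimensionDesignsStubVolumeCounting
import Summits.MatrixMultiplication.MatrixMultiplication.Theorems.GLnSeparatingDesignsBorderHalfDimensionDesignsStubInterpolationScale
import Summits.MatrixMultiplication.MatrixMultiplication.Theorems.GLnSeparatingDesignsBorderHalfDimensionDesignsStubTppOfExactSeparatorsMap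
import Summits.MatrixMultiplication.MatrixMultiplication.Theorems.GLnSeparatingDesignsBorderHalfDimensionDesignsStubFiniteFieldShadow
import Summits.MatrixMultiplication.MatrixMultiplication.Theorems.GLnSeparatingDesignsBorderHalfDimensionDesignsStubSplitOuterTimesInvariants
import Summits.MatrixMultiplication.MatrixMultiplication.Theorems.GLnSeparatingDesignsBorderHalfDimensionDesignsStubSplitCardLeFinrankSpan
import Summits.MatrixMultiplication.MatrixMultiplication.Theorems.GLnSeparatingDesignsBorderHalfDimensionDesignsStubSplitFinrankSpanLe
import Summits.MatrixMultiplication.MatrixMultiplication.Theorems.GLnSeparatingDesignsBorderHalfDimensionDesignsStubNotSplitOfSplitLaw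
import Summits.MatrixMultiplication.MatrixMultiplication.Theorems.BorderHalfDimensionDesigns.Negative.SplitDesignBarrier
import Summits.MatrixMultiplication.MatrixMultiplication.Theorems.BorderHalfDimensionDesigns.Negative.PIntegralShadowLaw
import Summits.MatrixMultiplication.MatrixMultiplication.Theorems.BorderHalfDimensionDesigns.Negative.SplitFormFalse

/-!
# Line `Ideate5Sketch` (card `continuous-quasirandom-law`, lens NEGATION) for crux `BorderHalfDimensionDesigns`
(stmt-MatrixMultiplication-18360, route `GLnSeparatingDesigns`) — lead a1's skeleton, state after wave 2

Composition: `stub_separationDegreeLaw` (C⁻, the conjectured uniform GL_n separation-degree law, n ≥ 3; OPEN,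
held by the lead — crux-sized, see work/LAW-ANALYSIS.md) and the LANDED transfer
`stub_not_borderHalfDimensionDesigns_of_law` (p163595; ε := 1/8, δ := 1/(16 n)) give
`not_BorderHalfDimensionDesigns : ¬ BorderHalfDimensionDesigns`.  The skeleton closes `¬ crux` modulo A alone.

Everything else of the line is LANDED and imported above:
* wave 1 — `stub_volume_sq_le_counting` (p163954, trivial-exponent law V² ≤ ((s+1)^(n²))³ for every design);
  `stub_interpolation_scale` (p164268); `stub_tpp_of_exact_separators_map` + `tpp_of_exact_separators_map_prod`
  (p164845); `stub_finiteFieldShadow` (p165254);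
* E1 assembled — `stub_pIntegral_volume_le` (p168259, `Negative/PIntegralShadowLaw.lean`): exactly readable designs over
  a ring mapping to 𝔽_p (p ≥ 5) have volume ≤ 2 p^(3n²/2 − (n−1)/2), conditional on the cited minimal degree of GL_n(𝔽_p);
* E2 = C⁻ for SPLIT designs (the strategist's split-design barrier), wave 2 — (i) `stub_split_outer_times_invariants_le`
  (p167260), (ii-a) `stub_split_card_le_finrank_span` (p167513), (ii-b) `stub_split_finrank_span_le` (p168128, lead),
  (iii) `stub_split_volume_le` (p168231, `Negative/SplitDesignBarrier.lean`: |X||Y||Z| ≤ s^(n(n−1)/2)·C(2s+n²,n²)),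
  (iv) `stub_not_split_of_splitLaw` (p167794), assembled `stub_not_splitBorderHalfDimensionDesigns`
  (p168376, `Negative/SplitFormFalse.lean`): the SPLIT FORM of the crux is false.
-/

set_option linter.dupNamespace false

open scoped BigOperators Matrix
open Summit.MatrixMultiplication.MatrixMultiplication.Theses.GLnSeparatingDesigns

namespace Summit.MatrixMultiplication.MatrixMultiplication.Theorems.BorderHalfDimensionDesigns

/-- STUB A (hardest; held by the lead) — **C⁻, the GL_n separation-degree law** (card
`continuous-quasirandom-law`, `SeparationDegreeLaw` restricted to `n ≥ 3`): every finite `X, Y, Z ⊆ GL_n(ℂ)`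
carrying `η`-approximate separators of total degree `≤ s` for every target, with `η·|X||Y||Z| < 1`, has
`|X|·|Y|·|Z| ≤ C(n) · (s+1)^(n(n−1)/2) · C(2s+n², n²)`.  CONJECTURAL (crux-sized): proved for split designs
(`stub_split_volume_le`, constant 1) and, in exponent, for exactly readable p-integral designs
(`stub_pIntegral_volume_le`); saving 0 (`stub_volume_sq_le_counting`) is all that is known in general. -/
theorem stub_separationDegreeLaw :
    ∀ n : ℕ, 3 ≤ n → ∃ C : ℝ, 0 < C ∧ ∀ s : ℕ, 2 ≤ s →
      ∀ (X Y Z : Finset (Matrix.GeneralLinearGroup (Fin n) ℂ)) (η : ℝ),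
        η * ((X.card : ℝ) * Y.card * Z.card) < 1 →
        (∀ x₀ ∈ X, ∀ z₀ ∈ Z, ∃ p : MvPolynomial (Fin n × Fin n) ℂ, p.totalDegree ≤ s ∧
          ∀ x ∈ X, ∀ y ∈ Y, ∀ y' ∈ Y, ∀ z ∈ Z,
            ((x = x₀ ∧ y = y' ∧ z = z₀) → ‖MvPolynomial.eval (fun ij : Fin n × Fin n =>
              ((x * y⁻¹ * y' * z⁻¹ : Matrix.GeneralLinearGroup (Fin n) ℂ) : Matrix (Fin n) (Fin n) ℂ) ij.1 ij.2) p - 1‖ ≤ η) ∧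
            (¬ (x = x₀ ∧ y = y' ∧ z = z₀) → ‖MvPolynomial.eval (fun ij : Fin n × Fin n =>
              ((x * y⁻¹ * y' * z⁻¹ : Matrix.GeneralLinearGroup (Fin n) ℂ) : Matrix (Fin n) (Fin n) ℂ) ij.1 ij.2) p‖ ≤ η)) →
        (X.card : ℝ) * Y.card * Z.card ≤
          C * ((s : ℝ) + 1) ^ (n * (n - 1) / 2) * ((2 * s + n ^ 2).choose (n ^ 2) : ℝ) := by
  sorry

/-- COMPOSITION of line `Ideate5Sketch`: C⁻ refutes the crux (closed modulo stub A; the transfer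
`stub_not_borderHalfDimensionDesigns_of_law` is the landed p163595). -/
theorem not_BorderHalfDimensionDesigns : ¬ BorderHalfDimensionDesigns :=
  stub_not_borderHalfDimensionDesigns_of_law stub_separationDegreeLaw

end Summit.MatrixMultiplication.MatrixMultiplication.Theorems.BorderHalfDimensionDesigns
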